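import Summits.HubbardSuperconductivity.HubbardSuperconductivity.Theorems.TwTipContinuation.Negative.TipNormalForm
import Literature.MathematicalPhysics.QuantumLattice.ProjectedBCSState
import Literature.MathematicalPhysics.QuantumLattice.HubbardModelParticleHoleProofs

/-!
# `TwTipContinuation` (stmt-HubbardSuperconductivity-1700), line `isogap-submodular-transport`,
# stub `stub_edgeOrder` — piece 3a(i): sector decomposition of spin-balanced vectors

A spin-balanced Fock vector (`N↑ = N↓` on its support, e.g. a fixed-phase BCS product state) is the
orthogonal sum of its components `ψ_m = sectorProj m m ψ` in the sectors `(N, S^z) = (2m, 0)`,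
`0 ≤ m ≤ |Λ|`. For a sector-preserving matrix `H` (`PreservesSectors`), `⟨ψ, Hψ⟩ = Σ_m ⟨ψ_m, Hψ_m⟩`;
hence any family of sector-wise variational lower bounds `F(m) ≤ re⟨φ,Hφ⟩/⟨φ,φ⟩` on `(2m,0)` gives
`Σ_m ‖ψ_m‖² F(m) ≤ re⟨ψ, Hψ⟩` (`sum_weight_mul_le_expect`), with weights `‖ψ_m‖²` summing to
`⟨ψ,ψ⟩` and number moments `Σ_m ‖ψ_m‖² (2m) = re⟨ψ,Nψ⟩`, `Σ_m ‖ψ_m‖² (2m − N̄)² = ‖Nψ − N̄ψ‖²`.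
Elementary linear algebra (block-diagonal Hermitian forms; Tasaki 2020 §2.2, §9.3).
-/

noncomputable section

namespace Summit.HubbardSuperconductivity.TwTipContinuation.IsogapTransport

open Matrix Finset
open Literature.MathematicalPhysics.QuantumLattice Literature.Probability.LatticeModels
open scoped ComplexOrder ComplexConjugate

variable {Λ : Type*} [LinearOrder Λ] [Fintype Λ]

/-- `upCount = #upPart`, `downCount = #downPart` (two spellings in the tree). [folklore] -/
theorem upCount_eq (s : Finset (Orb Λ)) : upCount s = (upPart s).card := rfl

/-- `downCount = #downPart`. [folklore] -/
theorem downCount_eq (s : Finset (Orb Λ)) : NagaokaTasaki.downCount s = (downPart s).card := rfl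

/-- On the support of a spin-balanced vector `N↑ = N↓`. [folklore] -/
theorem apply_eq_zero_of_mem_spinBalanced {ψ : Fock (Orb Λ)} (hψ : ψ ∈ spinBalanced)
    {s : Finset (Orb Λ)} (hs : (upPart s).card ≠ (downPart s).card) : ψ s = 0 :=
  hψ s hs

/-! ### The sector components -/

/-- **Resolution of a spin-balanced vector into its `(2m, S^z=0)` components**:
`ψ = Σ_{m ≤ |Λ|} sectorProj m m ψ`. [folklore] -/
theorem sum_sectorProj_eq_of_mem_spinBalanced {ψ : Fock (Orb Λ)} (hψ : ψ ∈ spinBalanced) :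
    ∑ m ∈ Finset.range (Fintype.card Λ + 1), sectorProj m m ψ = ψ := by
  funext s
  rw [Finset.sum_apply]
  simp only [sectorProj_apply]
  by_cases hs : (upPart s).card = (downPart s).card
  · rw [Finset.sum_eq_single (upPart s).card]
    · rw [if_pos ⟨rfl, hs.symm⟩]
    · intro m _ hm
      rw [if_neg]
      rintro ⟨h, -⟩
      exact hm h.symm
    · intro h
      exfalso
      apply h
      rw [Finset.mem_range]
      exact Nat.lt_succ_of_le (Finset.card_le_univ _)
  · rw [apply_eq_zero_of_mem_spinBalanced hψ hs]
    refine Finset.sum_eq_zero fun m _ => ?_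
    rw [if_neg]
    rintro ⟨h1, h2⟩
    exact hs (h1.trans h2.symm)

/-- Components in different sectors are orthogonal (disjoint supports). [folklore] -/
theorem star_sectorProj_dotProduct_sectorProj_of_ne {a b a' b' : ℕ} (h : ¬ (a = a' ∧ b = b'))
    (ψ φ : Fock (Orb Λ)) : star (sectorProj a b ψ) ⬝ᵥ sectorProj a' b' φ = 0 := by
  rw [dotProduct]
  refine Finset.sum_eq_zero fun s _ => ?_
  rw [Pi.star_apply, sectorProj_apply, sectorProj_apply]
  by_cases h1 : (upPart s).card = a ∧ (downPart s).card = b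
  · rw [if_pos h1, if_neg, mul_zero]
    rintro ⟨h2, h3⟩
    exact h ⟨h1.1.symm.trans h2, h1.2.symm.trans h3⟩
  · rw [if_neg h1, star_zero, zero_mul]

/-- The `(m,m)` component lies in the joint sector `(2m, S^z = 0)`. [folklore] -/
theorem sectorProj_mem_szSector (m : ℕ) (ψ : Fock (Orb Λ)) :
    sectorProj m m ψ ∈ szSector (Λ := Λ) (2 * m) (0 : ℝ) :=
  (mem_szSector_two_mul_zero_iff m _).2 (isInSector_sectorProj m m ψ)

/-- The `(m,m)` component is a `2m`-particle vector. [folklore] -/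
theorem isNParticle_sectorProj (m : ℕ) (ψ : Fock (Orb Λ)) : IsNParticle (2 * m) (sectorProj m m ψ) := by
  rw [two_mul]
  exact (isInSector_sectorProj m m ψ).isNParticle

/-! ### Block-diagonal quadratic forms -/

/-- **Block decomposition of a sector-preserving quadratic form** on a spin-balanced vector:
`⟨ψ, Mψ⟩ = Σ_{m ≤ |Λ|} ⟨ψ_m, Mψ_m⟩`. [folklore] -/
theorem star_dotProduct_mulVec_eq_sum_sectors {M : Matrix (Finset (Orb Λ)) (Finset (Orb Λ)) ℂ}
    (hM : PreservesSectors M) {ψ : Fock (Orb Λ)} (hψ : ψ ∈ spinBalanced) :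
    star ψ ⬝ᵥ (M *ᵥ ψ) =
      ∑ m ∈ Finset.range (Fintype.card Λ + 1), star (sectorProj m m ψ) ⬝ᵥ (M *ᵥ sectorProj m m ψ) := by
  conv_lhs => rw [← sum_sectorProj_eq_of_mem_spinBalanced hψ]
  rw [mulVec_sum, star_sum, sum_dotProduct]
  refine Finset.sum_congr rfl fun m hm => ?_
  rw [dotProduct_sum, Finset.sum_eq_single_of_mem m hm (fun m' _ hm' => ?_)]
  rw [hM.mulVec_sectorProj]
  exact star_sectorProj_dotProduct_sectorProj_of_ne (fun h => hm' h.1.symm) _ _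

/-- The same for the norm: `⟨ψ, ψ⟩ = Σ_m ⟨ψ_m, ψ_m⟩`. [folklore] -/
theorem star_dotProduct_self_eq_sum_sectors {ψ : Fock (Orb Λ)} (hψ : ψ ∈ spinBalanced) :
    star ψ ⬝ᵥ ψ = ∑ m ∈ Finset.range (Fintype.card Λ + 1), star (sectorProj m m ψ) ⬝ᵥ sectorProj m m ψ := by
  conv_lhs => rw [← sum_sectorProj_eq_of_mem_spinBalanced hψ]
  rw [star_sum, sum_dotProduct]
  refine Finset.sum_congr rfl fun m hm => ?_
  rw [dotProduct_sum, Finset.sum_eq_single_of_mem m hm (fun m' _ hm' => ?_)]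
  exact star_sectorProj_dotProduct_sectorProj_of_ne (fun h => hm' h.1.symm) _ _

/-- Gram sums of the components: `⟨Σ_m c_m ψ_m, Σ_m c'_m ψ_m⟩ = Σ_m conj(c_m) c'_m ⟨ψ_m, ψ_m⟩`. [folklore] -/
theorem star_sum_smul_sectorProj_dotProduct (c c' : ℕ → ℂ) (ψ : Fock (Orb Λ)) :
    star (∑ m ∈ Finset.range (Fintype.card Λ + 1), c m • sectorProj m m ψ) ⬝ᵥ
        (∑ m ∈ Finset.range (Fintype.card Λ + 1), c' m • sectorProj m m ψ) =
      ∑ m ∈ Finset.range (Fintype.card Λ + 1), star (c m) * c' m * (star (sectorProj m m ψ) ⬝ᵥ sectorProj m m ψ) := by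
  rw [star_sum, sum_dotProduct]
  refine Finset.sum_congr rfl fun m hm => ?_
  rw [dotProduct_sum, Finset.sum_eq_single_of_mem m hm (fun m' _ hm' => ?_)]
  · rw [star_smul, smul_dotProduct, dotProduct_smul, smul_eq_mul, smul_eq_mul, mul_assoc]
  · rw [star_smul, smul_dotProduct, dotProduct_smul,
      star_sectorProj_dotProduct_sectorProj_of_ne (fun h => hm' h.1.symm) _ _, smul_zero, smul_zero]

/-- `N ψ = Σ_m 2m ψ_m` for a spin-balanced `ψ`. [folklore] -/
theorem totalNumber_mulVec_eq_sum_sectors {ψ : Fock (Orb Λ)} (hψ : ψ ∈ spinBalanced) :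
    (totalNumber : Matrix (Finset (Orb Λ)) (Finset (Orb Λ)) ℂ) *ᵥ ψ =
      ∑ m ∈ Finset.range (Fintype.card Λ + 1), ((2 * m : ℕ) : ℂ) • sectorProj m m ψ := by
  conv_lhs => rw [← sum_sectorProj_eq_of_mem_spinBalanced hψ]
  rw [mulVec_sum]
  exact Finset.sum_congr rfl fun m _ => totalNumber_mulVec_of_isNParticle (isNParticle_sectorProj m ψ)

/-- **The weights sum to the norm**: `Σ_m ⟨ψ_m, ψ_m⟩ = ⟨ψ, ψ⟩` (real parts). [folklore] -/
theorem sum_weights_eq {ψ : Fock (Orb Λ)} (hψ : ψ ∈ spinBalanced) :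
    ∑ m ∈ Finset.range (Fintype.card Λ + 1), (star (sectorProj m m ψ) ⬝ᵥ sectorProj m m ψ).re =
      (star ψ ⬝ᵥ ψ).re := by
  rw [star_dotProduct_self_eq_sum_sectors hψ, Complex.re_sum]

/-- **First number moment**: `re⟨ψ, Nψ⟩ = Σ_m 2m ⟨ψ_m, ψ_m⟩`. [folklore] -/
theorem re_expect_totalNumber_eq_sum_sectors {ψ : Fock (Orb Λ)} (hψ : ψ ∈ spinBalanced) :
    (star ψ ⬝ᵥ ((totalNumber : Matrix (Finset (Orb Λ)) (Finset (Orb Λ)) ℂ) *ᵥ ψ)).re =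
      ∑ m ∈ Finset.range (Fintype.card Λ + 1), (2 * m : ℝ) * (star (sectorProj m m ψ) ⬝ᵥ sectorProj m m ψ).re := by
  have h1 : ψ = ∑ m ∈ Finset.range (Fintype.card Λ + 1), (1 : ℂ) • sectorProj m m ψ := by
    simp only [one_smul]; exact (sum_sectorProj_eq_of_mem_spinBalanced hψ).symm
  rw [totalNumber_mulVec_eq_sum_sectors hψ, congrArg star h1, star_sum_smul_sectorProj_dotProduct, Complex.re_sum]
  refine Finset.sum_congr rfl fun m _ => ?_
  rw [star_one, one_mul, show (((2 * m : ℕ) : ℂ)) = ((2 * m : ℝ) : ℂ) by push_cast; ring, Complex.re_ofReal_mul]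

/-- **Second number moment**: `‖Nψ − N̄ψ‖² = Σ_m (2m − N̄)² ⟨ψ_m, ψ_m⟩` for any real `N̄`. [folklore] -/
theorem variance_totalNumber_eq_sum_sectors {ψ : Fock (Orb Λ)} (hψ : ψ ∈ spinBalanced) (Nbar : ℝ) :
    (star ((totalNumber : Matrix (Finset (Orb Λ)) (Finset (Orb Λ)) ℂ) *ᵥ ψ - (Nbar : ℂ) • ψ) ⬝ᵥ
        ((totalNumber : Matrix (Finset (Orb Λ)) (Finset (Orb Λ)) ℂ) *ᵥ ψ - (Nbar : ℂ) • ψ)).re =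
      ∑ m ∈ Finset.range (Fintype.card Λ + 1), (2 * m - Nbar) ^ 2 * (star (sectorProj m m ψ) ⬝ᵥ sectorProj m m ψ).re := by
  have hdec : (totalNumber : Matrix (Finset (Orb Λ)) (Finset (Orb Λ)) ℂ) *ᵥ ψ - (Nbar : ℂ) • ψ =
      ∑ m ∈ Finset.range (Fintype.card Λ + 1), (((2 * m : ℕ) : ℂ) - (Nbar : ℂ)) • sectorProj m m ψ := by
    rw [totalNumber_mulVec_eq_sum_sectors hψ]
    conv_lhs => arg 2; rw [← sum_sectorProj_eq_of_mem_spinBalanced hψ]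
    rw [Finset.smul_sum, ← Finset.sum_sub_distrib]
    exact Finset.sum_congr rfl fun m _ => by rw [sub_smul]
  rw [hdec, star_sum_smul_sectorProj_dotProduct, Complex.re_sum]
  refine Finset.sum_congr rfl fun m _ => ?_
  have : star ((((2 * m : ℕ) : ℂ)) - (Nbar : ℂ)) * ((((2 * m : ℕ) : ℂ)) - (Nbar : ℂ)) =
      (((2 * m - Nbar) ^ 2 : ℝ) : ℂ) := by
    rw [show (((2 * m : ℕ) : ℂ)) - (Nbar : ℂ) = ((2 * m - Nbar : ℝ) : ℂ) by push_cast; ring]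
    rw [Complex.star_def, Complex.conj_ofReal, ← Complex.ofReal_mul, sq]
  rw [this, Complex.re_ofReal_mul]

/-- The weights are nonnegative. [folklore] -/
theorem weight_nonneg (m : ℕ) (ψ : Fock (Orb Λ)) : 0 ≤ (star (sectorProj m m ψ) ⬝ᵥ sectorProj m m ψ).re :=
  (Complex.nonneg_iff.1 (dotProduct_star_self_nonneg _)).1

/-- Scaling of a quadratic form: `⟨c x, M (c x)⟩ = conj(c) c ⟨x, M x⟩`. [folklore] -/
theorem star_smul_dotProduct_mulVec_smul {n : Type*} [Fintype n] (M : Matrix n n ℂ) (c : ℂ) (x : n → ℂ) :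
    star (c • x) ⬝ᵥ (M *ᵥ (c • x)) = star c * c * (star x ⬝ᵥ (M *ᵥ x)) := by
  rw [mulVec_smul, star_smul, smul_dotProduct, dotProduct_smul, smul_eq_mul, smul_eq_mul, mul_assoc]

/-- **Sector-wise variational bounds add up.** If `H` preserves sectors and `F(m)` is a lower
bound for the Rayleigh quotient of `H` on the sector `(2m, S^z=0)` for every `m ≤ |Λ|`, then for
every spin-balanced `ψ`: `Σ_m F(m) ⟨ψ_m, ψ_m⟩ ≤ re⟨ψ, Hψ⟩`. [folklore] -/
theorem sum_weight_mul_le_expect {H : Matrix (Finset (Orb Λ)) (Finset (Orb Λ)) ℂ} (hH : PreservesSectors H)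
    {ψ : Fock (Orb Λ)} (hψ : ψ ∈ spinBalanced) (F : ℕ → ℝ)
    (hF : ∀ m ∈ Finset.range (Fintype.card Λ + 1), ∀ φ ∈ szSector (Λ := Λ) (2 * m) (0 : ℝ),
      star φ ⬝ᵥ φ = 1 → F m ≤ (star φ ⬝ᵥ (H *ᵥ φ)).re) :
    ∑ m ∈ Finset.range (Fintype.card Λ + 1), F m * (star (sectorProj m m ψ) ⬝ᵥ sectorProj m m ψ).re ≤
      (star ψ ⬝ᵥ (H *ᵥ ψ)).re := by
  rw [star_dotProduct_mulVec_eq_sum_sectors hH hψ, Complex.re_sum]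
  refine Finset.sum_le_sum fun m hm => ?_
  by_cases hz : sectorProj m m ψ = 0
  · simp [hz]
  obtain ⟨c, hc, hc1⟩ := exists_smul_unit hz
  have hmem : c • sectorProj m m ψ ∈ szSector (Λ := Λ) (2 * m) (0 : ℝ) :=
    Submodule.smul_mem _ _ (sectorProj_mem_szSector m ψ)
  have hb := hF m hm _ hmem hc1
  have hcc : star c * c = ((‖c‖ ^ 2 : ℝ) : ℂ) := by
    rw [Complex.star_def, Complex.conj_mul', Complex.ofReal_pow]
  have hpos : 0 < ‖c‖ ^ 2 := by positivity
  rw [star_smul_dotProduct_mulVec_smul, hcc, Complex.re_ofReal_mul] at hb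
  rw [star_smul, smul_dotProduct, dotProduct_smul, smul_eq_mul, smul_eq_mul, ← mul_assoc, hcc] at hc1
  have hc1' := congrArg Complex.re hc1
  rw [Complex.re_ofReal_mul, Complex.one_re] at hc1'
  -- `‖c‖² ⟨ψ_m,ψ_m⟩ = 1` and `F ≤ ‖c‖² re⟨ψ_m, Hψ_m⟩`
  have hw : (star (sectorProj m m ψ) ⬝ᵥ sectorProj m m ψ).re = 1 / ‖c‖ ^ 2 := by
    field_simp
    linarith
  rw [hw, mul_one_div, div_le_iff₀ hpos]
  linarith

/-- **Sector-wise variational bounds add up (piece 3a(i) of `stub_edgeOrder`)**, on the fermionic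
torus: for a sector-preserving `H`, a spin-balanced `ψ` and sector-wise Rayleigh lower bounds `F`,
`Σ_m F(m) ⟨ψ_m, ψ_m⟩ ≤ re⟨ψ, Hψ⟩`. [folklore] -/
theorem sectorWeights_variational :
    ∀ (L : ℕ) (H : Matrix (Finset (Orb (FermionTorus 2 L))) (Finset (Orb (FermionTorus 2 L))) ℂ), PreservesSectors H → ∀ (ψ : Fock (Orb (FermionTorus 2 L))), ψ ∈ spinBalanced → ∀ (F : ℕ → ℝ), (∀ m ∈ Finset.range (Fintype.card (FermionTorus 2 L) + 1), ∀ φ ∈ szSector (Λ := FermionTorus 2 L) (2 * m) (0 : ℝ), star φ ⬝ᵥ φ = 1 → F m ≤ (star φ ⬝ᵥ (H *ᵥ φ)).re) → ∑ m ∈ Finset.range (Fintype.card (FermionTorus 2 L) + 1), F m * (star (sectorProj m m ψ) ⬝ᵥ sectorProj m m ψ).re ≤ (star ψ ⬝ᵥ (H *ᵥ ψ)).re :=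
  fun _ _ hH _ hψ F hF => sum_weight_mul_le_expect hH hψ F hF

end Summit.HubbardSuperconductivity.TwTipContinuation.IsogapTransport
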